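import Literature.MathematicalPhysics.QuantumFieldTheory.Balaban1983to89.B8Prop6DentedCubeMemberScalarGammaOfNamedFactsGRec
import Literature.MathematicalPhysics.QuantumFieldTheory.Balaban1983to89.B8SpecialLinearTrace
import Literature.MathematicalPhysics.QuantumFieldTheory.Balaban1983to89.B7Prop2SpecialUnitaryRec

/-!
# `Balaban1983to89.B8Prop6DentedCubeMemberScalarGammaSURec` — [Balaban1985RegularSpaces] PROPOSITION 6 (p. 99), (1.135)–(1.138) ∕ [Balaban1985Variational] (148)–(153), AT EVERY
# DENTED CENTRED CUBE MEMBER OF PRINT's BIG-BLOCK SUB-LATTICE FOR `G = SU(N)` ([Balaban1985Averaging] p. 20 «We consider a Lie subgroup G of a unitary group U(N)»; `SU(N)` the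
# case of record) AND THE RECORD's SYMMETRISED CENTRED block averaging (0.4) of [Balaban1987RG1]: the record `G`-crown of `B8Prop6DentedCubeMemberScalarGammaOfNamedFactsGRec` §4 AT
# `𝔸 = M_N(ℂ)`, `G = SU(N)` (`N ≤ 12`), `H = SL(N, ℂ)`, `τ = tr` — THE GAUGE TRANSFORMATION `u` AND `w = v⁻¹u` ARE SPECIAL UNITARY, UNCONDITIONALLY

statement-level skeleton of published theorems with citation tags; proofs where landed; nothing here is a claim about the Yang–Mills mass gap

T. Bałaban, *Spaces of regular gauge field configurations on a lattice and gauge fixing conditions*, Commun. Math. Phys. **99** (1985) 75–102 `[Balaban1985RegularSpaces]` ("[6]"):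
Prop. 6 (1.135)–(1.138) p. 99, p. 98, p. 76 («R(U)X = UXU⁻¹ for a unitary matrix U»), (1.17) p. 78; T. Bałaban, *The variational problem and background fields in renormalization
group method for lattice gauge theories*, Commun. Math. Phys. **102** (1985) 277–309 `[Balaban1985Variational]` ("[15]"): (148)–(153) p. 301; T. Bałaban, *Averaging operations for
lattice gauge theories*, Commun. Math. Phys. **98** (1985) 17–51 `[Balaban1985Averaging]` ("[3]"): p. 18, p. 20, (20)–(23) p. 21, (42)–(43) pp. 23–24; T. Bałaban, *Propagators for
lattice gauge theories in a background field*, Commun. Math. Phys. **99** (1985) 389–434 `[Balaban1985BackgroundPropagators]` ("[4]"): (3.14)–(3.15) p. 393, Thms 3.1–3.3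
pp. 398–399; T. Bałaban, *Renormalization group approach to lattice gauge field theories. I*, Commun. Math. Phys. **109** (1987) 249–301 `[Balaban1987RG1]` ("[I]"): (0.3)–(0.4)
pp. 252–253.  STATUS: published, refereed.

CITATION HEADER (lean-in-tree rule).  Cell `pub-ymgap`, «N05-REC» R8 = the `G`∕τ-EDITION OF RECORD (desk `R6-PLAN.md` §6 (B)), file G8 = THE SU(N) LETTER dag-n07-w3's `DatumCrownAt` ∕
`RecordCrownSU` asks (p721358 :86–:126: `u x ∈ specialUnitaryUnits (Fin N)` and `(vfix U₀)⁻¹·u ∈ SU(N)`; shape word «N ≤ 12 of record suffices», bus 16:45:09Z) — LEAD PEN dag-n05-e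
g40.  WHAT IS CERTIFIED.  ★★★ `gaugedBoundB8DZ_dentedMember_scalar_γ_holds_specialUnitary` (`d ≥ 2`, odd `L = 2s+1 ≥ 5`, `N ≤ 12`): (G7)'s
`gaugedBoundB8DZ_dentedMember_scalar_γ_holds_mem` with the joint J-SU data INHABITED — `τ := B8SpecialUnitaryTrace.trCLM` (tracial: `trCLM_mul_comm`), `G := specialUnitaryUnits (Fin N)`,
`H := B13Inv214OrbitSUN.slUnits N`, (H2) `B8SpecialLinearTrace.trCLM_mlog_eq_zero_of_mem_slUnits` (`N ≤ 25`), (H3) `expUnit_mem_slUnits`, `specialUnitaryUnits_le_slUnits`,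
`specialUnitaryUnits_le_unitaryUnits`, `B7Prop2SpecialUnitaryRec.avgClosedZ_specialUnitary` (`SU(N)` closed under the RECORD's averaging, `N ≤ 12` — this seat g37, LOCATE L2),
`B8SpecialUnitaryTrace.gaugeExp_mem_specialUnitaryUnits`.  One `exact`.  Engine twin: `B8Prop6CubeMemberScalarGammaHoldsSU` (this seat g33, pure cube member, engine averaging).
Kind «kernel-checked proof», theorems only: no `def`, no `… : Prop` fact, no `instance` (the `CStarAlgebra (Matrix …)` structure is a `letI` inside statement and proof, as in the
engine file), no `notation`, no existing module modified.  `--supports stmt-QuantumFields-20541` (K0⁷-keyed, COUNT-NEUTRAL).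

HONEST SCOPE.  Instantiation only; the analytic content is that of the record chain (Theorem 4 ∕ Prop. 5 ∕ Sect. E ∕ [4] Thms 3.1–3.3 of record, dag-n05-cov's Cov facts) plus the
trace-free bookkeeping of R8; NO new estimate; UNCONDITIONAL as a Literature theorem — STILL NOT a node discharge: `HThm4Rec` UNDISCHARGED; N05 ∕ N07 NOT discharged; K0⁷'s
stubs untouched; COUNT of record unmoved; one finite `𝕋⁴` programme at fixed `ε`, Bałaban AS PRINTED; nothing continuum ∕ ℝ⁴ ∕ OS ∕ mass-gap ∕ Clay.  No `sorry`, no `def`.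
-/

noncomputable section

namespace Literature.MathematicalPhysics.QuantumFieldTheory.Balaban1983to89.B8Prop6DentedCubeMemberScalarGammaSURec

open scoped Matrix
open MatrixLog B7Prop1Explicit B7Prop2Explicit B7Prop1Local B7Eq92Concrete
open BlockAveragingZd (ctrShift avgIterZ)
open B7SectEFLinearisationRec (logCovIterZ)
open B8Ineq132 (covDerivFwd InAk)
open B8Eq140Level (SideTouches)
open B8Eq143PlaqExpansion (pdiv)
open B8Eq146AExpansion (iEta plaqCovDeriv)
open B8ScaledSupNorm (bondNorm msup)
open B8Eq184Proof (gaugeExp cfgExp)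
open B8Eq138LandauZd (covLap logCfg)
open B8Eq138LandauZdRec (IsLandau138WZ)
open B8Eq119TwistedAxialRec (Restr129Z)
open B8Eq131Cubes (tLo tHi)
open B8Eq131CubesRec (bLoZ bHiZ)
open B8Ineq130Rec (tlo thi)
open MatrixLog (mlog)
open NormedSpace
open Node00 (CubeB8DZ)
open Literature.MathematicalPhysics.QuantumLattice (blockMap)
open B8Prop6DentedCubeMemberScalarGammaOfNamedFactsGRec (gaugedBoundB8DZ_dentedMember_scalar_γ_holds_mem)

export B7Prop1Explicit (Site)

variable {d : ℕ}

/-! ## §1  AT `𝔸 = M_N(ℂ)`, `G = SU(N)` (`N ≤ 12`), `H = SL(N, ℂ)`, `τ = tr`: PROPOSITION 6 AT THE DENTED RECORD MEMBER WITH A SPECIAL-UNITARY GAUGE TRANSFORMATION -/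

section SpecialUnitary

open scoped Matrix.Norms.L2Operator
open B7Prop2SpecialUnitary (specialUnitaryUnits specialUnitaryUnits_le_unitaryUnits)
open B13Inv214OrbitSUN (slUnits)
open B8SpecialUnitaryTrace (trCLM trCLM_mul_comm gaugeExp_mem_specialUnitaryUnits)
open B8SpecialLinearTrace (specialUnitaryUnits_le_slUnits trCLM_mlog_eq_zero_of_mem_slUnits expUnit_mem_slUnits)
open B7Prop2SpecialUnitaryRec (avgClosedZ_specialUnitary)

open Classical in
/-- ★★★ **PROPOSITION 6 (p. 99) ∕ [15] (148)–(153) AT EVERY DENTED CENTRED CUBE MEMBER OF PRINT's BIG-BLOCK SUB-LATTICE WITH A SPECIAL-UNITARY GAUGE TRANSFORMATION — `G = SU(N)`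
([Balaban1985Averaging] p. 20's Lie subgroup `G ≤ U(N)`, the case of record), THE RECORD's CENTRED AVERAGING, `d ≥ 2`, odd `L = 2s+1 ≥ 5`, `N ≤ 12` — UNCONDITIONALLY**: (G7)'s
`gaugedBoundB8DZ_dentedMember_scalar_γ_holds_mem` at `𝔸 := M_N(ℂ)`, `τ := tr` (`B8SpecialUnitaryTrace.trCLM`), `G := SU(N)` (`B7Prop2SpecialUnitary.specialUnitaryUnits`), `H :=
SL(N, ℂ)` (`B13Inv214OrbitSUN.slUnits`), the joint J-SU data inhabited by `B8SpecialLinearTrace` ((H2) `trCLM_mlog_eq_zero_of_mem_slUnits`, (H3) `expUnit_mem_slUnits`,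
`specialUnitaryUnits_le_slUnits`), `B7Prop2SpecialUnitaryRec.avgClosedZ_specialUnitary` (`SU(N)` closed under the record's (0.4) averaging, `N ≤ 12`) and
`B8SpecialUnitaryTrace.gaugeExp_mem_specialUnitaryUnits` (`e^{iλ} ∈ SU(N)` for Hermitian trace-free `λ`): there are `B₀ ≥ 1`, `c₁ > 0` and thresholds `ρ₀, M₀, N₀, R₀` such that for
every `η > 0`, every dented RECORD cube datum `c : CubeB8DZ d L K Ω` on print's p. 98 sub-lattice above threshold with the anchored dent premise, every `SU(N)`-VALUED
`U₀ ∈ 𝔄_K({Ω_j}, α₀)` with `7dL²·c.M·α₀ ≤ c₁`: the twelve clauses of `GaugedBoundB8DZ L η U₀ c (7dL²·(5dLB₀)·c.M·α₀)` hold with the gauge transformation `u` of (1.135)–(1.138) AND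
`v⁻¹u` `SU(N)`-VALUED.  (`Node00.GaugedBoundB8DZ` itself follows by `specialUnitaryUnits_le_unitaryUnits` and the anonymous constructor.)
[cite: Balaban1985RegularSpaces, Prop. 6 (1.135)–(1.138) p.99, p.98, p.76, (1.17) p.78; Balaban1985Variational, (148)–(153) p.301; Balaban1985Averaging, p.18, p.20, (20)–(23) p.21, (42)–(43) pp.23–24; Balaban1985BackgroundPropagators, (3.14)–(3.15) p.393, Thms 3.1–3.3 pp.398–399; Balaban1987RG1, (0.3)–(0.4) pp.252–253] -/
theorem gaugedBoundB8DZ_dentedMember_scalar_γ_holds_specialUnitary (hd2 : 2 ≤ d) {L sL : ℕ} (hLs : L = 2 * sL + 1) (hs2 : 2 ≤ sL) {N : ℕ} [NeZero N] (hN : N ≤ 12) :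
    letI : CStarAlgebra (Matrix (Fin N) (Fin N) ℂ) := {}
    ∃ B₀ c₁ ρ₀ M₀ : ℝ, ∃ N₀ R₀ : ℕ, 1 ≤ B₀ ∧ 0 < c₁ ∧ ∀ (η : ℝ), 0 < η → ∀ {K : ℕ} {Ω : ℕ → Set (Site d)} (c : CubeB8DZ d L K Ω),
      ∀ (s R : ℕ), 3 ≤ L ^ s → M₀ ≤ (L : ℝ) ^ (s + 1) → L ^ (s + 1) ∣ c.ρ → L ^ (s + 1) ∣ c.M → R * L ^ (s + 1) ≤ c.ρ → 2 * L ≤ R →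
        R₀ ≤ R → N₀ + 1 ≤ R * L ^ (s + 1) → ρ₀ ≤ (c.ρ : ℝ) →
      (∀ x y : Site d,
          blockMap (L ^ (s + 1) * L ^ c.k) (x - fun i => (L : ℤ) ^ c.k * (c.a i - c.ρ) - (ctrShift L c.k : ℤ)) =
            blockMap (L ^ (s + 1) * L ^ c.k) (y - fun i => (L : ℤ) ^ c.k * (c.a i - c.ρ) - (ctrShift L c.k : ℤ)) → x ∈ Ω c.k → y ∈ Ω c.k) →
      ∀ (U₀ : Site d → Fin d → (Matrix (Fin N) (Fin N) ℂ)ˣ), (∀ x κ, U₀ x κ ∈ specialUnitaryUnits (Fin N)) → ∀ (α₀ : ℝ), 0 < α₀ → InAk L K η α₀ Ω U₀ →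
      7 * d * (L : ℝ) ^ 2 * c.M * α₀ ≤ c₁ →
      ∃ u : Site d → (Matrix (Fin N) (Fin N) ℂ)ˣ, (∀ x, u x ∈ specialUnitaryUnits (Fin N)) ∧ (∀ x, x ∉ c.sq 0 → u x = 1) ∧
        Restr129Z L c.k c.lamS (1 : Site d → Fin d → (Matrix (Fin N) (Fin N) ℂ)ˣ) u ∧
        IsLandau138WZ L c.k η (c.sq 0) c.lamS (1 : Site d → Fin d → (Matrix (Fin N) (Fin N) ℂ)ˣ) (c.fixed U₀ u) ∧
        (∀ j, j ≤ c.k → ∀ b ∈ {b : Site d × Fin d | SideTouches (c.sq j) b.1 b.2},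
          c.fixed U₀ u b.1 b.2 = cfgExp η (logCfg η (c.fixed U₀ u)) b.1 b.2 ∧ IsSelfAdjoint (logCfg η (c.fixed U₀ u) b.1 b.2) ∧
            ‖logCfg η (c.fixed U₀ u) b.1 b.2‖ ≤ (7 * d * (L : ℝ) ^ 2 * (5 * (d : ℝ) * L * B₀) * c.M * α₀) * ((L : ℝ) ^ j * η)⁻¹) ∧
        (∀ x, ((c.vfix U₀)⁻¹ * u) x ∈ specialUnitaryUnits (Fin N)) ∧
        AgreeOn (tlo L (tLo c.a c.ρ) c.k) (thi L (tHi c.a c.M c.ρ) c.k) (gaugeAct ((c.vfix U₀)⁻¹ * u)⁻¹ U₀) (c.fixed U₀ u) ∧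
        msup L c.k η (-(2 : ℝ)) (fun j (t : Fin d × Fin d × Site d) => SideTouches (c.sq j) t.2.2 t.2.1)
            (fun t => covDerivFwd η (1 : Site d → Fin d → (Matrix (Fin N) (Fin N) ℂ)ˣ) t.1 (fun z => c.expo η U₀ u z t.2.1) t.2.2) ≤ (7 * d * (L : ℝ) ^ 2 * (5 * (d : ℝ) * L * B₀) * c.M * α₀) ∧
        bondNorm L c.k η (-(3 : ℝ)) c.sq
            (fun x μ => pdiv η (1 : Site d → Fin d → (Matrix (Fin N) (Fin N) ℂ)ˣ) (plaqCovDeriv η (1 : Site d → Fin d → (Matrix (Fin N) (Fin N) ℂ)ˣ) (c.expo η U₀ u)) μ x) ≤ (7 * d * (L : ℝ) ^ 2 * (5 * (d : ℝ) * L * B₀) * c.M * α₀) ∧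
        bondNorm L c.k η (-(3 : ℝ)) c.sq (fun x μ => covLap η (1 : Site d → Fin d → (Matrix (Fin N) (Fin N) ℂ)ˣ) (fun z => c.expo η U₀ u z μ) x) ≤ (7 * d * (L : ℝ) ^ 2 * (5 * (d : ℝ) * L * B₀) * c.M * α₀) ∧
        (∀ (x : Site d) (μ : Fin d), bLoZ L c.a 0 0 ≤ x → x + e μ ≤ bHiZ L c.a c.M 0 0 → c.inTop x → c.inTop (x + e μ) →
          logCovIterZ L (1 : Site d → Fin d → (Matrix (Fin N) (Fin N) ℂ)ˣ) (iEta η (c.expo η U₀ u)) c.k x μ = mlog ((avgIterZ L (c.axial U₀) c.k x μ : (Matrix (Fin N) (Fin N) ℂ)ˣ) : Matrix (Fin N) (Fin N) ℂ)) := by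
  letI : CStarAlgebra (Matrix (Fin N) (Fin N) ℂ) := {}
  have hN' : Fintype.card (Fin N) ≤ 12 := by rw [Fintype.card_fin]; exact hN
  exact gaugedBoundB8DZ_dentedMember_scalar_γ_holds_mem (𝔸 := Matrix (Fin N) (Fin N) ℂ) (trCLM (Fin N)) trCLM_mul_comm hd2 hLs hs2
    (G := specialUnitaryUnits (Fin N)) (H := slUnits N)
    (fun g hg hs => trCLM_mlog_eq_zero_of_mem_slUnits (le_trans hN (by norm_num)) hg hs) (fun S hS => expUnit_mem_slUnits hS)
    (avgClosedZ_specialUnitary d L hN') specialUnitaryUnits_le_slUnits specialUnitaryUnits_le_unitaryUnits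
    (fun lam hsa htr x => gaugeExp_mem_specialUnitaryUnits hsa htr x)

#print axioms gaugedBoundB8DZ_dentedMember_scalar_γ_holds_specialUnitary

end SpecialUnitary

end Literature.MathematicalPhysics.QuantumFieldTheory.Balaban1983to89.B8Prop6DentedCubeMemberScalarGammaSURec

end
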